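import Literature.AlgebraicGeometry.Motives.AbelianVarietyCotangentOfFibreEndo
import Literature.AlgebraicGeometry.Morphisms.SectionConormalChartFinite
import Literature.AlgebraicGeometry.Motives.AbelianVarietyGoodReductionFrobenius
import HarnessLib

/-!
# The cotangent lattice of a good-reduction datum: ONE module over `𝓞_{k,𝔓}` carrying the action of an endomorphism,
# with both fibres the cotangent spaces of `A` and of its reduction `Ã` (Shimura 1998 §11.1 / §13.2; Görtz–Wedhorn II 17.14–17.15)

Topic `Literature/AlgebraicGeometry/Motives`, namespace `Literature.AlgebraicGeometry.Motives.AbelianVariety.GoodReductionAt`.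
THEOREMS only (the lattice `M`, its endomorphism `γ` and the two fibre isomorphisms are `∃`-witnesses); no named fact,
no `def`, no instance (net Literature debt 0).  Cell `hodgecm-mathlib` (D-0151), row II-1, EDITION E2 (the height-one road to
the degree-one Shimura–Taniyama congruence `shimuraTaniyamaPair_degOne'`), piece **P1-char (β1)** of A-p02's P1 sub-skeleton
(`stub_P1char`: the cotangent characteristic polynomials of `u` on `A` and of `ũ = R.redEnd u` on `Ã` are the two images of ONE
monic polynomial over `𝓞_{k,𝔓}`).  HC_CM is proved only modulo the 7 printed citations until rung 0 closes.

THE PRINT.  [Shimura1998] §13.2 (proof of §13.1 Thm. 1, pp. 98–99) reads the action of `ι(a)` on the invariant differential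
forms of the model and of its reduction («`ω̃ᵢ ∘ ι̃(a) = a^{φᵢ} ω̃ᵢ`»); scheme-theoretically (Görtz–Wedhorn II, (17.3), Remark 17.14,
Remark 17.15 (1)) the conormal module `M = I/I²` of the ZERO SECTION `e : Spec 𝓞_{k,𝔓} → 𝒳` of a model `𝒳` of `A` is a finite
`𝓞_{k,𝔓}`-module on which every `𝓞_{k,𝔓}`-endomorphism `v` of `𝒳` fixing `e` acts (`γ_v = sectionConormalEndo`), and for each of
the two points `Spec k → Spec 𝓞_{k,𝔓}` (generic) and `Spec κ(𝔓) → Spec 𝓞_{k,𝔓}` (closed) the fibre `κ ⊗ M` is the cotangent space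
at the origin of the corresponding fibre of `𝒳`, equivariantly (`Motives/AbelianVarietyCotangentOfFibre(Endo)`:
`cotangentFibreEquiv`, `cotangentMap_eq_conj`).

WHAT IS PROVED.  For an abelian variety `A` over a number field `k`, a good-reduction datum `R : A.GoodReductionAt 𝔓` (a BARE
smooth proper model `R.model` of `A.X` over `O = 𝓞_{k,𝔓} = valuationSubringAtPrime k 𝔓`, its reduction `R.reduction` over `κ(𝔓)`,
`R.liftEnd`, `R.redEnd`), an endomorphism `u : End A`, and a section `e` of the model whose generic point is the origin of `A`
(`hgen`), whose closed point is the origin of `R.reduction` (`hsp`) and which is fixed by `R.liftEnd u` (`hev`) — exactly the three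
heads of the zero-section file (A-p09, piece (α): `exists_zeroSection`, `unitPt_reduction_comp_eq`, `zeroSection_comp_liftEnd_left`),
taken here as HYPOTHESES so that this file is independent of it:
* `isPullback_genericToModel`, `isPullback_reductionToModel` — the two fibre squares of the model through `R.model.genericIso` and
  `R.reductionIso`;
* `toSchemeHom_comp_genericToModel`, `toSchemeHom_redEnd_comp_reductionToModel` — `u` and `R.redEnd u` cover `R.liftEnd u`;
* **`exists_cotangentLattice_conj`** — there are a finite `O`-module `M`, `γ : M →ₗ[O] M`, and isomorphisms
  `Φ : k ⊗_O M ≃ T_e^*(A)`, `Ψ : κ(𝔓) ⊗_O M ≃ T_e^*(Ã)` (for the `O`-algebra structure `residueAt 𝔓` on `κ(𝔓)`) with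
  `(u)^* = Φ ∘ (γ ⊗ k) ∘ Φ⁻¹` and `(ũ)^* = Ψ ∘ (γ ⊗ κ(𝔓)) ∘ Ψ⁻¹`.
The integrator (A-p11, piece (β2)) deduces that `M` is free of rank `dim A` (both fibre ranks are `dim A`) and hence `stub_P1char`
with `P := γ.charpoly`.

## References
* [Shimura1998] G. Shimura, *Abelian Varieties with Complex Multiplication and Modular Functions*, Princeton 1998, §11.1 Prop. 12,
  §13.2 (pp. 98–99), §12.4 Prop. 26 (p. 109).
* [GortzWedhorn2023] U. Görtz, T. Wedhorn, *Algebraic Geometry II* (2023), (17.3), Remark 17.14, Remark 17.15 (1).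
* [GortzWedhorn2020] U. Görtz, T. Wedhorn, *Algebraic Geometry I*, 2nd ed. (2020), Prop. 4.20, Section (4.7).
-/

set_option autoImplicit false

noncomputable section

-- `TopCat.Presheaf` is not reducible (as in Mathlib's `AlgebraicGeometry/Modules` and the tree's `Morphisms/SectionConormalChart`).
set_option backward.isDefEq.respectTransparency false

open CategoryTheory CategoryTheory.Limits AlgebraicGeometry TopologicalSpace Opposite TensorProduct
open IsDedekindDomain IsDedekindDomain.HeightOneSpectrum
open scoped NumberField
open Literature.RingTheory.Smooth Literature.AlgebraicGeometry.Morphisms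

namespace Literature.AlgebraicGeometry.Motives

namespace AbelianVariety

namespace GoodReductionAt

variable {k : Type} [Field k] [NumberField k] {A : AbelianVariety k} {𝔓 : HeightOneSpectrum (𝓞 k)}
  (R : A.GoodReductionAt 𝔓)

/-! ## §1 A section of a scheme over a local ring lies in one affine chart -/

/-- For a local ring `O`, every morphism `e : Spec O → X` factors set-theoretically through ONE affine open `W` of `X`
(an affine neighbourhood of the image of the closed point; its preimage is an open of `Spec O` containing the closed point,
hence everything — Mathlib `Scheme.preimage_eq_top_of_closedPoint_mem`; private: the public form lives in the zero-section file `Motives/IntegralModelSection`). [cite: GortzWedhorn2020, Prop. 3.2 and Example 2.16 (local schemes)] -/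
private theorem exists_isAffineOpen_preimage_eq_top {O : Type} [CommRing O] [IsLocalRing O] {X : Scheme.{0}}
    (e : Spec (.of O) ⟶ X) : ∃ W : X.Opens, IsAffineOpen W ∧ e ⁻¹ᵁ W = ⊤ := by
  obtain ⟨W, hW, hxW, -⟩ := exists_isAffineOpen_mem_and_subset
    (x := e.base (IsLocalRing.closedPoint O)) (U := ⊤) trivial
  exact ⟨W, hW, Scheme.preimage_eq_top_of_closedPoint_mem e hxW⟩

/-! ## §2 The two fibre squares of the model -/

/-- **The generic fibre square**: `A.X → 𝒳` (through `R.model.genericIso⁻¹` and the first projection of `𝒳 ×_O k`) is the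
pullback of `𝒳 → Spec O` along `Spec k → Spec O`. [cite: GortzWedhorn2020, Section (4.7)] -/
theorem isPullback_genericToModel :
    IsPullback (R.model.genericIso.inv.left ≫ baseChangeHomFst (algebraMap (valuationSubringAtPrime k 𝔓) k) R.model.total)
      A.X.hom R.model.total.hom (Spec.map (CommRingCat.ofHom (algebraMap (valuationSubringAtPrime k 𝔓) k))) := by
  have t : IsPullback (baseChangeHomFst (algebraMap (valuationSubringAtPrime k 𝔓) k) R.model.total)
      ((baseChangeHom (algebraMap (valuationSubringAtPrime k 𝔓) k)).obj R.model.total).hom R.model.total.hom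
      (Spec.map (CommRingCat.ofHom (algebraMap (valuationSubringAtPrime k 𝔓) k))) :=
    IsPullback.of_hasPullback _ _
  haveI : IsIso R.model.genericIso.inv.left := inferInstanceAs (IsIso ((Over.forget _).mapIso R.model.genericIso).inv)
  have s : IsPullback R.model.genericIso.inv.left A.X.hom
      ((baseChangeHom (algebraMap (valuationSubringAtPrime k 𝔓) k)).obj R.model.total).hom (𝟙 _) :=
    IsPullback.of_horiz_isIso ⟨by rw [Category.comp_id]; exact Over.w R.model.genericIso.inv⟩
  simpa only [Category.id_comp] using s.paste_horiz t

/-- **The special fibre square**: `Ã.X → 𝒳` (through `R.reductionIso` and the first projection of `𝒳 ×_O κ(𝔓)`) is the pullback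
of `𝒳 → Spec O` along `Spec κ(𝔓) → Spec O`. [cite: GortzWedhorn2020, Section (4.7)] [cite: Shimura1998, §11.1 (p. 83)] -/
theorem isPullback_reductionToModel :
    IsPullback (R.reductionIso.hom.left ≫ baseChangeHomFst (residueAt 𝔓) R.model.total)
      R.reduction.X.hom R.model.total.hom (Spec.map (CommRingCat.ofHom (residueAt 𝔓))) := by
  have t : IsPullback (baseChangeHomFst (residueAt 𝔓) R.model.total)
      ((baseChangeHom (residueAt 𝔓)).obj R.model.total).hom R.model.total.hom (Spec.map (CommRingCat.ofHom (residueAt 𝔓))) :=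
    IsPullback.of_hasPullback _ _
  haveI : IsIso R.reductionIso.hom.left := inferInstanceAs (IsIso ((Over.forget _).mapIso R.reductionIso).hom)
  have s : IsPullback R.reductionIso.hom.left R.reduction.X.hom
      ((baseChangeHom (residueAt 𝔓)).obj R.model.total).hom (𝟙 _) :=
    IsPullback.of_horiz_isIso ⟨by rw [Category.comp_id]; exact Over.w R.reductionIso.hom⟩
  simpa only [Category.id_comp] using s.paste_horiz t

/-- **`u` covers its lift**: `u ≫ (A.X → 𝒳) = (A.X → 𝒳) ≫ R.liftEnd u` (the generic fibre of `R.liftEnd u` is `u`,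
`R.liftEnd_left_comp`, and naturality of the first projection). [cite: Shimura1998, §11.1 Prop. 12] -/
theorem toSchemeHom_comp_genericToModel (u : End A) :
    Hom.toSchemeHom (u : A ⟶ A) ≫
        (R.model.genericIso.inv.left ≫ baseChangeHomFst (algebraMap (valuationSubringAtPrime k 𝔓) k) R.model.total) =
      (R.model.genericIso.inv.left ≫ baseChangeHomFst (algebraMap (valuationSubringAtPrime k 𝔓) k) R.model.total) ≫
        (R.liftEnd u).left := by
  have hinv : R.model.genericIso.hom.left ≫ R.model.genericIso.inv.left = 𝟙 _ := by
    rw [← Over.comp_left, Iso.hom_inv_id, Over.id_left]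
  have hinv' : R.model.genericIso.inv.left ≫ R.model.genericIso.hom.left = 𝟙 _ := by
    rw [← Over.comp_left, Iso.inv_hom_id, Over.id_left]
  have h := R.liftEnd_left_comp u
  -- naturality of the first projection (`Motives.baseChange O k = baseChangeHom (algebraMap O k)` definitionally)
  have hbc : ((Motives.baseChange (valuationSubringAtPrime k 𝔓) k).map (R.liftEnd u)).left ≫
        baseChangeHomFst (algebraMap (valuationSubringAtPrime k 𝔓) k) R.model.total =
      baseChangeHomFst (algebraMap (valuationSubringAtPrime k 𝔓) k) R.model.total ≫ (R.liftEnd u).left :=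
    baseChangeHom_map_left_comp_fst (algebraMap (valuationSubringAtPrime k 𝔓) k) (R.liftEnd u)
  have h1 : Hom.toSchemeHom (u : A ⟶ A) ≫ R.model.genericIso.inv.left =
      R.model.genericIso.inv.left ≫ ((Motives.baseChange (valuationSubringAtPrime k 𝔓) k).map (R.liftEnd u)).left :=
    calc Hom.toSchemeHom (u : A ⟶ A) ≫ R.model.genericIso.inv.left
        = (R.model.genericIso.inv.left ≫ R.model.genericIso.hom.left) ≫ Hom.toSchemeHom (u : A ⟶ A) ≫
            R.model.genericIso.inv.left := by rw [hinv', Category.id_comp]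
      _ = R.model.genericIso.inv.left ≫ (R.model.genericIso.hom.left ≫ Hom.toSchemeHom (u : A ⟶ A)) ≫
            R.model.genericIso.inv.left := by simp only [Category.assoc]
      _ = R.model.genericIso.inv.left ≫
            (((Motives.baseChange (valuationSubringAtPrime k 𝔓) k).map (R.liftEnd u)).left ≫ R.model.genericIso.hom.left) ≫
            R.model.genericIso.inv.left := by rw [h]
      _ = R.model.genericIso.inv.left ≫ ((Motives.baseChange (valuationSubringAtPrime k 𝔓) k).map (R.liftEnd u)).left := by
          rw [Category.assoc, hinv, Category.comp_id]
  calc Hom.toSchemeHom (u : A ⟶ A) ≫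
        (R.model.genericIso.inv.left ≫ baseChangeHomFst (algebraMap (valuationSubringAtPrime k 𝔓) k) R.model.total)
      = (Hom.toSchemeHom (u : A ⟶ A) ≫ R.model.genericIso.inv.left) ≫
          baseChangeHomFst (algebraMap (valuationSubringAtPrime k 𝔓) k) R.model.total := (Category.assoc _ _ _).symm
    _ = (R.model.genericIso.inv.left ≫ ((Motives.baseChange (valuationSubringAtPrime k 𝔓) k).map (R.liftEnd u)).left) ≫
          baseChangeHomFst (algebraMap (valuationSubringAtPrime k 𝔓) k) R.model.total := by rw [h1]
    _ = R.model.genericIso.inv.left ≫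
          (baseChangeHomFst (algebraMap (valuationSubringAtPrime k 𝔓) k) R.model.total ≫ (R.liftEnd u).left) := by
          rw [Category.assoc, hbc]
    _ = (R.model.genericIso.inv.left ≫ baseChangeHomFst (algebraMap (valuationSubringAtPrime k 𝔓) k) R.model.total) ≫
          (R.liftEnd u).left := (Category.assoc _ _ _).symm

/-- **`ũ = R.redEnd u` covers the lift**: `ũ ≫ (Ã.X → 𝒳) = (Ã.X → 𝒳) ≫ R.liftEnd u` (the special fibre of `R.liftEnd u` is
`R.redEnd u`, `R.redEnd_left_comp`). [cite: Shimura1998, §11.1 Prop. 12] -/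
theorem toSchemeHom_redEnd_comp_reductionToModel (u : End A) :
    Hom.toSchemeHom (R.redEnd u : R.reduction ⟶ R.reduction) ≫
        (R.reductionIso.hom.left ≫ baseChangeHomFst (residueAt 𝔓) R.model.total) =
      (R.reductionIso.hom.left ≫ baseChangeHomFst (residueAt 𝔓) R.model.total) ≫ (R.liftEnd u).left := by
  rw [← Category.assoc, R.redEnd_left_comp u, Category.assoc, Category.assoc, baseChangeHom_map_left_comp_fst]

/-! ## §3 The cotangent lattice -/

/-- **The cotangent lattice of a good-reduction datum.**  Let `R : A.GoodReductionAt 𝔓` be a good-reduction datum (a smooth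
proper model `𝒳` of `A` over `O = 𝓞_{k,𝔓}` with its reduction `Ã = R.reduction`), `u` an endomorphism of `A`, and
`e : Spec O → 𝒳` a section whose generic point is the origin of `A` (`hgen`), whose closed point is the origin of `Ã` (`hsp`), and
which is fixed by the lift `R.liftEnd u` (`hev`) — the zero section.  Then there are a finite `O`-module `M` (the conormal module
`I/I²` of `e` in an affine chart), an `O`-endomorphism `γ` of `M` (the action of `R.liftEnd u`), and isomorphisms
`Φ : k ⊗_O M ≃ T_e^*(A)`, `Ψ : κ(𝔓) ⊗_O M ≃ T_e^*(Ã)` (for the `O`-algebra structure `residueAt 𝔓 : O → κ(𝔓)`) such that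
`u^* = Φ (γ ⊗ k) Φ⁻¹` on `T_e^*(A)` and `ũ^* = Ψ (γ ⊗ κ(𝔓)) Ψ⁻¹` on `T_e^*(Ã)`: the cotangent actions of `u` and of its reduction
are the two fibres of ONE lattice endomorphism (Shimura's invariant differentials on the model, §13.2; Görtz–Wedhorn II,
Remark 17.14 / 17.15 (1)). [cite: Shimura1998, §13.2 (pp. 98–99) and §11.1 Prop. 12] [cite: GortzWedhorn2023, Remark 17.14 and Remark 17.15 (1)] -/
theorem exists_cotangentLattice_conj (u : End A)
    (e : Spec (.of (valuationSubringAtPrime k 𝔓)) ⟶ R.model.total.left) (he : e ≫ R.model.total.hom = 𝟙 _)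
    (hgen : Spec.map (CommRingCat.ofHom (algebraMap (valuationSubringAtPrime k 𝔓) k)) ≫ e =
      unitPt A ≫ R.model.genericIso.inv.left ≫ baseChangeHomFst (algebraMap (valuationSubringAtPrime k 𝔓) k) R.model.total)
    (hsp : unitPt R.reduction ≫ R.reductionIso.hom.left ≫ baseChangeHomFst (residueAt 𝔓) R.model.total =
      Spec.map (CommRingCat.ofHom (residueAt 𝔓)) ≫ e)
    (hev : e ≫ (R.liftEnd u).left = e) :
    letI := (residueAt 𝔓).toAlgebra
    ∃ (M : Type) (_ : AddCommGroup M) (_ : Module (valuationSubringAtPrime k 𝔓) M)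
      (_ : Module.Finite (valuationSubringAtPrime k 𝔓) M) (γ : M →ₗ[valuationSubringAtPrime k 𝔓] M)
      (Φ : k ⊗[valuationSubringAtPrime k 𝔓] M ≃ₗ[k] Cotangent A)
      (Ψ : 𝔓.asIdeal.ResidueField ⊗[valuationSubringAtPrime k 𝔓] M ≃ₗ[𝔓.asIdeal.ResidueField] Cotangent R.reduction),
      cotangentMap A (u : A ⟶ A) = Φ.conj (γ.baseChange k) ∧
        cotangentMap R.reduction (R.redEnd u : R.reduction ⟶ R.reduction) = Ψ.conj (γ.baseChange 𝔓.asIdeal.ResidueField) := by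
  letI := (residueAt 𝔓).toAlgebra
  -- the model, an affine chart of the whole section, the conormal module `M = I/I²` (finite: `O` is noetherian, `𝒳` proper)
  set f := R.model.total.hom with hf
  haveI : IsProper f := R.isSmoothProper.2
  obtain ⟨W, hW, heW⟩ := exists_isAffineOpen_preimage_eq_top e
  haveI hfin : Module.Finite (valuationSubringAtPrime k 𝔓) (augIdeal (sectionAug f e he heW)).Cotangent :=
    finite_cotangent_sectionAug_of_isNoetherianRing f e he heW hW
  -- the lift `v` of `u` fixes the section; a basic open `D(h) ⊆ W ∩ v⁻¹ W` containing the section; `γ = γ_v`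
  set v : R.model.total.left ⟶ R.model.total.left := (R.liftEnd u).left with hv_def
  have hv : v ≫ f = f := Over.w (R.liftEnd u)
  have heO : e ⁻¹ᵁ (v ⁻¹ᵁ W) = ⊤ := by rw [← Scheme.Hom.comp_preimage, hev]; exact heW
  obtain ⟨h, hh, hhv⟩ := exists_sectionAug_eq_one_and_basicOpen_le f e he heW hW _ heO
  let γ := sectionConormalEndo f e he heW v hv hev h hhv hW hh
  -- generic fibre
  let p₁ := R.model.genericIso.inv.left ≫ baseChangeHomFst (algebraMap (valuationSubringAtPrime k 𝔓) k) R.model.total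
  have hP₁ : IsPullback p₁ A.X.hom f (Spec.map (CommRingCat.ofHom (algebraMap (valuationSubringAtPrime k 𝔓) k))) :=
    R.isPullback_genericToModel
  have horig₁ : unitPt A ≫ p₁ = Spec.map (CommRingCat.ofHom (algebraMap (valuationSubringAtPrime k 𝔓) k)) ≫ e := hgen.symm
  have hU₁ : IsAffineOpen (p₁ ⁻¹ᵁ W) := isAffineOpen_preimage_of_isPullback f p₁ A.X.hom hP₁ hW
  have heU₁ : origin A ∈ p₁ ⁻¹ᵁ W := origin_mem_preimage e A p₁ horig₁ W heW
  have hu₁ : Hom.toSchemeHom (u : A ⟶ A) ≫ p₁ = p₁ ≫ v := R.toSchemeHom_comp_genericToModel u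
  -- special fibre
  let p₂ := R.reductionIso.hom.left ≫ baseChangeHomFst (residueAt 𝔓) R.model.total
  have hP₂ : IsPullback p₂ R.reduction.X.hom f
      (Spec.map (CommRingCat.ofHom (algebraMap (valuationSubringAtPrime k 𝔓) 𝔓.asIdeal.ResidueField))) :=
    R.isPullback_reductionToModel
  have horig₂ : unitPt R.reduction ≫ p₂ =
      Spec.map (CommRingCat.ofHom (algebraMap (valuationSubringAtPrime k 𝔓) 𝔓.asIdeal.ResidueField)) ≫ e := hsp
  have hU₂ : IsAffineOpen (p₂ ⁻¹ᵁ W) := isAffineOpen_preimage_of_isPullback f p₂ R.reduction.X.hom hP₂ hW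
  have heU₂ : origin R.reduction ∈ p₂ ⁻¹ᵁ W := origin_mem_preimage e R.reduction p₂ horig₂ W heW
  have hu₂ : Hom.toSchemeHom (R.redEnd u : R.reduction ⟶ R.reduction) ≫ p₂ = p₂ ≫ v :=
    R.toSchemeHom_redEnd_comp_reductionToModel u
  exact ⟨(augIdeal (sectionAug f e he heW)).Cotangent, inferInstance, inferInstance, hfin, γ,
    cotangentFibreEquiv f e he hW heW A p₁ hP₁ horig₁ hU₁ heU₁,
    cotangentFibreEquiv f e he hW heW R.reduction p₂ hP₂ horig₂ hU₂ heU₂,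
    cotangentMap_eq_conj f e he hW heW A p₁ hP₁ horig₁ hU₁ heU₁ v hv hev (u : A ⟶ A) hu₁ h hh hhv,
    cotangentMap_eq_conj f e he hW heW R.reduction p₂ hP₂ horig₂ hU₂ heU₂ v hv hev
      (R.redEnd u : R.reduction ⟶ R.reduction) hu₂ h hh hhv⟩

end GoodReductionAt

end AbelianVariety

end Literature.AlgebraicGeometry.Motives

end
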